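import Summits.ResolutionOfSingularities.ResolutionOfSingularities.Theorems.FrobeniusLadderFRationalResolutionChartAlgebraNormalForm
import HarnessLib

/-!
# Crux `FrobeniusLadder.FRationalResolution` (stmt-ResolutionOfSingularities-15317), line `redirect`,
# stub `stub_diagonalizableQuotientResolution` — **the torus-fixed prime of a chart algebra over a log
# regular point: existence as a prime, uniqueness, unit face, residue ring, maximal ideal**
# (point-blow-up recursion for the surface case over arbitrary fields, memo MEMO-15317-leafhand2-g6
# §3–§4; part 2 of 2, continuing `…ChartAlgebraNormalForm`)

Setting and hypotheses (D), (K), (S), (H) as in part 1: a chart `φ : P → A` log regular at `𝔭` with unit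
face `F_𝔭`, `L = ℤF_𝔭`, and a chart algebra `C = A[χ(Q)]`, `χ : Q → C` extending `φ` along `P ≤ Q ⊆ ℤⁿ`
(every chart `A[I/φ(a)]` of a log blow-up and its iterates). With `J = 𝔭C + χ(Q ∖ L)C`:

* **`exists_isPrime_comap_eq_forall_mem_iff`** — there is a PRIME `𝔓₀ = {x : φ(f)x ∈ J, f ∈ F_𝔭}` of
  `C` over `𝔭`, containing exactly the chart elements `χ(q)`, `q ∉ L` (unit face `Q ∩ L`), modulo which
  every `x ∈ C` is congruent to an element of `A` up to a denominator `φ(f)` (residue field `κ(𝔭)`): the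
  torus-fixed point of the chart over `x = 𝔭` (Kato (10.1): the closed orbit of the fan of the
  modification over `x`);
* **`mem_iff_exists_val_mul_mem_span`, `eq_of_comap_eq_of_forall_mem`** — UNIQUENESS: any prime over `𝔭`
  containing `χ(Q ∖ L)` is that set; two such primes coincide (pure algebra, no log regularity);
* `not_mem_iff_mem_span_of_comap_eq`, `mem_faceMonoid_iff_of_comap_eq` — at such a prime the unit face of
  `χ` is `Q ∩ L`;
* **`maximalIdeal_eq_sup_map`** — `𝔪_{C_𝔓} = 𝔭·C_𝔓 + I(𝔓, χ)·C_𝔓`, Kato's ideal of the chart `χ` at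
  `𝔓` plus the image of `𝔭`; in particular at a point `𝔭` of zero-dimensional log stratum
  (`𝔭A_𝔭 = I(𝔭, φ)A_𝔭`, `…LogClosedStratumPoint`) the fixed point is again of zero-dimensional stratum
  — the recursion hypothesis of the point-blow-up programme reproduces itself.

Honest label: generic local algebra toward ONE leaf stub (no stub, crux or summit closed). No definitions,
no named facts, no sorry. [cite: Kato1994, Def. (2.1), (6.1), (10.1)] [cite: Niziol2006, §4]
-/

noncomputable section

-- single-problem summit: the doubled namespace component is forced
set_option linter.dupNamespace false

open IsLocalRing Literature.AlgebraicGeometry.Resolution Literature.AlgebraicGeometry.Resolution.LogChart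
open Summit.ResolutionOfSingularities.ResolutionOfSingularities.Theorems.FRationalResolution.ChartAlgebraNormalForm

namespace Summit.ResolutionOfSingularities.ResolutionOfSingularities.Theorems.FRationalResolution.ChartAlgebraFixedPoint

universe u

variable {A : Type u} [CommRing A] {n : ℕ} {P : AddSubmonoid (Fin n → ℤ)} {φ : Multiplicative P →* A}
  {𝔭 : Ideal A} [𝔭.IsPrime] {C : Type u} [CommRing C] [Algebra A C] {Q : AddSubmonoid (Fin n → ℤ)}
  {χ : Multiplicative Q →* C}

/-! ### The fixed prime: existence, face, residue ring -/

/-- **The torus-fixed prime over `𝔭`.** Under the hypotheses of `comap_span_eq` there is a prime `𝔓₀`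
of `C` with `𝔓₀ ∩ A = 𝔭`, whose chart non-units are exactly `χ(Q ∖ ℤF_𝔭)` (unit face `Q ∩ ℤF_𝔭`),
and modulo which every element of `C` is an element of `A` up to a denominator `φ(f)`, `f ∈ F_𝔭`
(residue field `κ(𝔭)`): `𝔓₀ = {x : φ(f)x ∈ 𝔭C + χ(Q ∖ ℤF_𝔭)C for some f ∈ F_𝔭}`.
[cite: Kato1994, (10.1)] -/
theorem exists_isPrime_comap_eq_forall_mem_iff [IsNoetherianRing A] (hP : P.FG)
    (hsat : ∀ (v : Fin n → ℤ) (k : ℕ), 0 < k → k • v ∈ P → v ∈ P) (hreg : IsLogRegularAt P φ 𝔭)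
    (hPQ : P ≤ Q)
    (hχ : ∀ p : P, χ (Multiplicative.ofAdd ⟨(p : Fin n → ℤ), hPQ p.2⟩) =
      algebraMap A C (φ (Multiplicative.ofAdd p)))
    (hgen : Algebra.adjoin A (Set.range χ) = ⊤)
    (hD : ∀ q ∈ Q, ∃ p ∈ P, q + p ∈ P)
    (hK : ∀ a : A, algebraMap A C a = 0 → ∃ p : P, φ (Multiplicative.ofAdd p) * a = 0)
    (hS : ∀ q₁ ∈ Q, ∀ q₂ ∈ Q, q₁ + q₂ ∈ Submodule.span ℤ (faceMonoid P φ 𝔭 : Set (Fin n → ℤ)) →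
      q₁ ∈ Submodule.span ℤ (faceMonoid P φ 𝔭 : Set (Fin n → ℤ)))
    (hH : ∀ q ∈ Q, ∀ p ∈ P, q + p ∈ Submodule.span ℤ (faceMonoid P φ 𝔭 : Set (Fin n → ℤ)) →
      q ∈ Submodule.span ℤ (faceMonoid P φ 𝔭 : Set (Fin n → ℤ))) :
    ∃ 𝔓 : Ideal C, 𝔓.IsPrime ∧ 𝔓.comap (algebraMap A C) = 𝔭 ∧
      (∀ q : Q, χ (Multiplicative.ofAdd q) ∈ 𝔓 ↔
        (q : Fin n → ℤ) ∉ Submodule.span ℤ (faceMonoid P φ 𝔭 : Set (Fin n → ℤ))) ∧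
      (∀ x : C, ∃ f ∈ faceMonoid P φ 𝔭, ∃ a : A, algebraMap A C (val P φ f) * x - algebraMap A C a ∈ 𝔓) ∧
      (∀ x : C, x ∈ 𝔓 ↔ ∃ f ∈ faceMonoid P φ 𝔭, algebraMap A C (val P φ f) * x ∈
        Ideal.span ((algebraMap A C '' (𝔭 : Set A)) ∪ ((fun q : Q => χ (Multiplicative.ofAdd q)) ''
          {q : Q | (q : Fin n → ℤ) ∉ Submodule.span ℤ (faceMonoid P φ 𝔭 : Set (Fin n → ℤ))}))) := by
  classical
  set J : Ideal C := Ideal.span ((algebraMap A C '' (𝔭 : Set A)) ∪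
    ((fun q : Q => χ (Multiplicative.ofAdd q)) ''
      {q : Q | (q : Fin n → ℤ) ∉ Submodule.span ℤ (faceMonoid P φ 𝔭 : Set (Fin n → ℤ))})) with hJdef
  have hJA : J.comap (algebraMap A C) = 𝔭 := comap_span_eq hP hsat hreg hPQ hχ hgen hD hK hS hH
  have hNJ : Submodule.span A ((fun q : Q => χ (Multiplicative.ofAdd q)) ''
      {q : Q | (q : Fin n → ℤ) ∉ Submodule.span ℤ (faceMonoid P φ 𝔭 : Set (Fin n → ℤ))}) ≤
      J.restrictScalars A :=
    Submodule.span_le.2 fun z hz => Ideal.subset_span (Or.inr hz)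
  have h𝔭J : ∀ π ∈ 𝔭, algebraMap A C π ∈ J := fun π hπ => Ideal.subset_span (Or.inl ⟨π, hπ, rfl⟩)
  -- the candidate
  let 𝔓 : Ideal C :=
    { carrier := {x | ∃ f ∈ faceMonoid P φ 𝔭, algebraMap A C (val P φ f) * x ∈ J}
      add_mem' := by
        rintro x y ⟨f, hf, hx⟩ ⟨g, hg, hy⟩
        refine ⟨f + g, (faceMonoid P φ 𝔭).add_mem hf hg, ?_⟩
        rw [val_add P φ hf.1 hg.1, map_mul, mul_add,
          show algebraMap A C (val P φ f) * algebraMap A C (val P φ g) * x =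
            algebraMap A C (val P φ g) * (algebraMap A C (val P φ f) * x) by ring,
          show algebraMap A C (val P φ f) * algebraMap A C (val P φ g) * y =
            algebraMap A C (val P φ f) * (algebraMap A C (val P φ g) * y) by ring]
        exact J.add_mem (J.mul_mem_left _ hx) (J.mul_mem_left _ hy)
      zero_mem' := ⟨0, (faceMonoid P φ 𝔭).zero_mem, by rw [mul_zero]; exact J.zero_mem⟩
      smul_mem' := by
        rintro c x ⟨f, hf, hx⟩
        exact ⟨f, hf, by rw [smul_eq_mul, mul_left_comm]; exact J.mul_mem_left _ hx⟩ }
  have hmem𝔓 : ∀ x : C, x ∈ 𝔓 ↔ ∃ f ∈ faceMonoid P φ 𝔭, algebraMap A C (val P φ f) * x ∈ J :=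
    fun x => Iff.rfl
  have hJ𝔓 : J ≤ 𝔓 := fun x hx => ⟨0, (faceMonoid P φ 𝔭).zero_mem, by
    rw [val_zero, map_one, one_mul]; exact hx⟩
  -- `𝔓 ∩ A = 𝔭`
  have hcomap : 𝔓.comap (algebraMap A C) = 𝔭 := by
    refine le_antisymm ?_ fun π hπ => hJ𝔓 (h𝔭J π hπ)
    rintro a ⟨f, hf, ha⟩
    rw [← map_mul] at ha
    have h2 : val P φ f * a ∈ 𝔭 := by rw [← hJA]; exact ha
    exact (Ideal.IsPrime.mem_or_mem ‹_› h2).resolve_left hf.2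
  -- primality
  have hprime : 𝔓.IsPrime := by
    refine ⟨?_, ?_⟩
    · intro htop
      have h1 : (1 : C) ∈ 𝔓 := by rw [htop]; trivial
      have : (1 : A) ∈ 𝔓.comap (algebraMap A C) := by rw [Ideal.mem_comap, map_one]; exact h1
      rw [hcomap] at this
      exact Ideal.IsPrime.ne_top' (Ideal.eq_top_of_isUnit_mem _ this isUnit_one)
    · intro x y hxy
      obtain ⟨h, hh, hxyJ⟩ := hxy
      obtain ⟨f, hf, a, z, hz, hxe⟩ := exists_val_mul_eq_add (𝔭 := 𝔭) hPQ hχ hgen x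
      obtain ⟨g, hg, b, w, hw, hye⟩ := exists_val_mul_eq_add (𝔭 := 𝔭) hPQ hχ hgen y
      -- `φ(h f g)·x y = φ(h)(a b) + (J-part)`
      have hab : algebraMap A C (val P φ h * (a * b)) ∈ J := by
        have e1 : algebraMap A C (val P φ h * (a * b)) =
            algebraMap A C (val P φ f) * algebraMap A C (val P φ g) *
              (algebraMap A C (val P φ h) * (x * y)) -
            algebraMap A C (val P φ h) * (algebraMap A C a * w + z * algebraMap A C b + z * w) := by
          rw [show algebraMap A C (val P φ f) * algebraMap A C (val P φ g) *
              (algebraMap A C (val P φ h) * (x * y)) = algebraMap A C (val P φ h) *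
              ((algebraMap A C (val P φ f) * x) * (algebraMap A C (val P φ g) * y)) by ring, hxe, hye,
            map_mul, map_mul]
          ring
        rw [e1]
        refine J.sub_mem (J.mul_mem_left _ hxyJ) (J.mul_mem_left _ ?_)
        exact J.add_mem (J.add_mem (J.mul_mem_left _ (hNJ hw)) (J.mul_mem_right _ (hNJ hz)))
          (J.mul_mem_left _ (hNJ hw))
      have hab' : val P φ h * (a * b) ∈ 𝔭 := by rw [← hJA]; exact hab
      have hab'' : a * b ∈ 𝔭 := (Ideal.IsPrime.mem_or_mem ‹_› hab').resolve_left hh.2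
      rcases Ideal.IsPrime.mem_or_mem ‹_› hab'' with ha | hb
      · exact Or.inl ⟨f, hf, by rw [hxe]; exact J.add_mem (h𝔭J a ha) (hNJ hz)⟩
      · exact Or.inr ⟨g, hg, by rw [hye]; exact J.add_mem (h𝔭J b hb) (hNJ hw)⟩
  refine ⟨𝔓, hprime, hcomap, fun q => ⟨fun hq hqL => ?_, fun hq => hJ𝔓 (Ideal.subset_span
    (Or.inr ⟨q, hq, rfl⟩))⟩, fun x => ?_, hmem𝔓⟩
  · -- `q = f₁ − f₂ ∈ ℤF`: `χ(q) φ(f₂) = φ(f₁) ∉ 𝔓`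
    obtain ⟨f₁, hf₁, f₂, hf₂, h12⟩ := (mem_span_int_iff_exists_sub _).1 hqL
    have hprod : χ (Multiplicative.ofAdd q) * algebraMap A C (val P φ f₂) = algebraMap A C (val P φ f₁) := by
      rw [← chi_mk_eq_algebraMap_val hPQ hχ hf₂.1, ← chi_mk_eq_algebraMap_val hPQ hχ hf₁.1, ← map_mul]
      congr 1
      apply Multiplicative.toAdd.injective
      apply Subtype.ext
      change (q : Fin n → ℤ) + f₂ = f₁
      rw [h12]; abel
    have h1 : algebraMap A C (val P φ f₁) ∈ 𝔓 := by rw [← hprod]; exact 𝔓.mul_mem_right _ hq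
    have h2 : val P φ f₁ ∈ 𝔓.comap (algebraMap A C) := h1
    rw [hcomap] at h2
    exact hf₁.2 h2
  · obtain ⟨f, hf, a, y, hy, hxe⟩ := exists_val_mul_eq_add (𝔭 := 𝔭) hPQ hχ hgen x
    exact ⟨f, hf, a, by rw [hxe, add_sub_cancel_left]; exact hJ𝔓 (hNJ hy)⟩

/-! ### Uniqueness and the shape of a fixed prime -/

/-- **Membership in a fixed prime.** If `𝔓` is a prime of `C` over `𝔭` containing `χ(Q ∖ ℤF_𝔭)`,
then `x ∈ 𝔓 ↔ φ(f)·x ∈ 𝔭C + χ(Q ∖ ℤF_𝔭)C` for some `f ∈ F_𝔭` (normal form: `φ(f)x = a + y`, and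
`a ∈ 𝔓 ∩ A = 𝔭`). Only the algebraic hypotheses are needed. [cite: Kato1994, (10.1)] -/
theorem mem_iff_exists_val_mul_mem_span (hPQ : P ≤ Q)
    (hχ : ∀ p : P, χ (Multiplicative.ofAdd ⟨(p : Fin n → ℤ), hPQ p.2⟩) =
      algebraMap A C (φ (Multiplicative.ofAdd p)))
    (hgen : Algebra.adjoin A (Set.range χ) = ⊤) {𝔓 : Ideal C} [𝔓.IsPrime]
    (h𝔓 : 𝔓.comap (algebraMap A C) = 𝔭)
    (hq : ∀ q : Q, (q : Fin n → ℤ) ∉ Submodule.span ℤ (faceMonoid P φ 𝔭 : Set (Fin n → ℤ)) →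
      χ (Multiplicative.ofAdd q) ∈ 𝔓) (x : C) :
    x ∈ 𝔓 ↔ ∃ f ∈ faceMonoid P φ 𝔭, algebraMap A C (val P φ f) * x ∈
      Ideal.span ((algebraMap A C '' (𝔭 : Set A)) ∪ ((fun q : Q => χ (Multiplicative.ofAdd q)) ''
        {q : Q | (q : Fin n → ℤ) ∉ Submodule.span ℤ (faceMonoid P φ 𝔭 : Set (Fin n → ℤ))})) := by
  have hJ𝔓 : Ideal.span ((algebraMap A C '' (𝔭 : Set A)) ∪ ((fun q : Q => χ (Multiplicative.ofAdd q)) ''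
      {q : Q | (q : Fin n → ℤ) ∉ Submodule.span ℤ (faceMonoid P φ 𝔭 : Set (Fin n → ℤ))})) ≤ 𝔓 := by
    refine Ideal.span_le.2 ?_
    rintro _ (⟨π, hπ, rfl⟩ | ⟨q, hq', rfl⟩)
    · have : π ∈ 𝔓.comap (algebraMap A C) := by rw [h𝔓]; exact hπ
      exact this
    · exact hq q hq'
  have hunit : ∀ f ∈ faceMonoid P φ 𝔭, algebraMap A C (val P φ f) ∉ 𝔓 := by
    intro f hf h
    have : val P φ f ∈ 𝔓.comap (algebraMap A C) := h
    rw [h𝔓] at this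
    exact hf.2 this
  constructor
  · intro hx
    obtain ⟨f, hf, a, y, hy, hxe⟩ := exists_val_mul_eq_add (𝔭 := 𝔭) hPQ hχ hgen x
    have hNJ : Submodule.span A ((fun q : Q => χ (Multiplicative.ofAdd q)) ''
        {q : Q | (q : Fin n → ℤ) ∉ Submodule.span ℤ (faceMonoid P φ 𝔭 : Set (Fin n → ℤ))}) ≤
        (Ideal.span ((algebraMap A C '' (𝔭 : Set A)) ∪ ((fun q : Q => χ (Multiplicative.ofAdd q)) ''
          {q : Q | (q : Fin n → ℤ) ∉ Submodule.span ℤ (faceMonoid P φ 𝔭 : Set (Fin n → ℤ))}))).restrictScalars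
          A :=
      Submodule.span_le.2 fun z hz => Ideal.subset_span (Or.inr hz)
    have hyJ := hNJ hy
    have ha𝔓 : algebraMap A C a ∈ 𝔓 := by
      have h1 : algebraMap A C (val P φ f) * x ∈ 𝔓 := 𝔓.mul_mem_left _ hx
      rw [hxe] at h1
      simpa using 𝔓.sub_mem h1 (hJ𝔓 hyJ)
    have ha𝔭 : a ∈ 𝔭 := by
      have : a ∈ 𝔓.comap (algebraMap A C) := ha𝔓
      rwa [h𝔓] at this
    exact ⟨f, hf, by rw [hxe]; exact Ideal.add_mem _ (Ideal.subset_span (Or.inl ⟨a, ha𝔭, rfl⟩)) hyJ⟩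
  · rintro ⟨f, hf, h⟩
    exact (Ideal.IsPrime.mem_or_mem ‹_› (hJ𝔓 h)).resolve_left (hunit f hf)

/-- **Uniqueness of the fixed point**: two primes of `C` over `𝔭` containing `χ(Q ∖ ℤF_𝔭)` coincide.
[cite: Kato1994, (10.1)] -/
theorem eq_of_comap_eq_of_forall_mem (hPQ : P ≤ Q)
    (hχ : ∀ p : P, χ (Multiplicative.ofAdd ⟨(p : Fin n → ℤ), hPQ p.2⟩) =
      algebraMap A C (φ (Multiplicative.ofAdd p)))
    (hgen : Algebra.adjoin A (Set.range χ) = ⊤) {𝔓 𝔓' : Ideal C} [𝔓.IsPrime] [𝔓'.IsPrime]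
    (h𝔓 : 𝔓.comap (algebraMap A C) = 𝔭) (h𝔓' : 𝔓'.comap (algebraMap A C) = 𝔭)
    (hq : ∀ q : Q, (q : Fin n → ℤ) ∉ Submodule.span ℤ (faceMonoid P φ 𝔭 : Set (Fin n → ℤ)) →
      χ (Multiplicative.ofAdd q) ∈ 𝔓)
    (hq' : ∀ q : Q, (q : Fin n → ℤ) ∉ Submodule.span ℤ (faceMonoid P φ 𝔭 : Set (Fin n → ℤ)) →
      χ (Multiplicative.ofAdd q) ∈ 𝔓') : 𝔓 = 𝔓' := by
  ext x
  rw [mem_iff_exists_val_mul_mem_span hPQ hχ hgen h𝔓 hq, mem_iff_exists_val_mul_mem_span hPQ hχ hgen h𝔓' hq']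

/-- **The unit face at a fixed prime is `Q ∩ ℤF_𝔭`**: for a prime `𝔓` of `C` over `𝔭` containing
`χ(Q ∖ ℤF_𝔭)`, a chart element `χ(q)` is a unit at `𝔓` iff `q ∈ ℤF_𝔭` (`q = f₁ − f₂` gives
`χ(q)φ(f₂) = φ(f₁) ∉ 𝔓`). [cite: Kato1994, (10.1)] -/
theorem not_mem_iff_mem_span_of_comap_eq (hPQ : P ≤ Q)
    (hχ : ∀ p : P, χ (Multiplicative.ofAdd ⟨(p : Fin n → ℤ), hPQ p.2⟩) =
      algebraMap A C (φ (Multiplicative.ofAdd p))) {𝔓 : Ideal C} [𝔓.IsPrime]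
    (h𝔓 : 𝔓.comap (algebraMap A C) = 𝔭)
    (hq : ∀ q : Q, (q : Fin n → ℤ) ∉ Submodule.span ℤ (faceMonoid P φ 𝔭 : Set (Fin n → ℤ)) →
      χ (Multiplicative.ofAdd q) ∈ 𝔓) (q : Q) :
    χ (Multiplicative.ofAdd q) ∉ 𝔓 ↔ (q : Fin n → ℤ) ∈ Submodule.span ℤ (faceMonoid P φ 𝔭 : Set (Fin n → ℤ)) := by
  constructor
  · intro h
    by_contra hL
    exact h (hq q hL)
  · intro hqL hq𝔓
    obtain ⟨f₁, hf₁, f₂, hf₂, h12⟩ := (mem_span_int_iff_exists_sub _).1 hqL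
    have hprod : χ (Multiplicative.ofAdd q) * algebraMap A C (val P φ f₂) = algebraMap A C (val P φ f₁) := by
      rw [← chi_mk_eq_algebraMap_val hPQ hχ hf₂.1, ← chi_mk_eq_algebraMap_val hPQ hχ hf₁.1, ← map_mul]
      congr 1
      apply Multiplicative.toAdd.injective
      apply Subtype.ext
      change (q : Fin n → ℤ) + f₂ = f₁
      rw [h12]; abel
    have h1 : algebraMap A C (val P φ f₁) ∈ 𝔓 := by rw [← hprod]; exact 𝔓.mul_mem_right _ hq𝔓
    have h2 : val P φ f₁ ∈ 𝔓.comap (algebraMap A C) := h1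
    rw [h𝔓] at h2
    exact hf₁.2 h2

/-- The face monoid of `χ` at a fixed prime, as a set: `F_𝔓(χ) = Q ∩ ℤF_𝔭`. [cite: Kato1994, (10.1)] -/
theorem mem_faceMonoid_iff_of_comap_eq (hPQ : P ≤ Q)
    (hχ : ∀ p : P, χ (Multiplicative.ofAdd ⟨(p : Fin n → ℤ), hPQ p.2⟩) =
      algebraMap A C (φ (Multiplicative.ofAdd p))) {𝔓 : Ideal C} [𝔓.IsPrime]
    (h𝔓 : 𝔓.comap (algebraMap A C) = 𝔭)
    (hq : ∀ q : Q, (q : Fin n → ℤ) ∉ Submodule.span ℤ (faceMonoid P φ 𝔭 : Set (Fin n → ℤ)) →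
      χ (Multiplicative.ofAdd q) ∈ 𝔓) (v : Fin n → ℤ) :
    v ∈ faceMonoid Q χ 𝔓 ↔ v ∈ Q ∧ v ∈ Submodule.span ℤ (faceMonoid P φ 𝔭 : Set (Fin n → ℤ)) := by
  rw [mem_faceMonoid]
  constructor
  · rintro ⟨hv, hv'⟩
    rw [val_of_mem Q χ hv] at hv'
    exact ⟨hv, (not_mem_iff_mem_span_of_comap_eq hPQ hχ h𝔓 hq ⟨v, hv⟩).1 hv'⟩
  · rintro ⟨hv, hvL⟩
    refine ⟨hv, ?_⟩
    rw [val_of_mem Q χ hv]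
    exact (not_mem_iff_mem_span_of_comap_eq hPQ hχ h𝔓 hq ⟨v, hv⟩).2 hvL

/-- **The maximal ideal at a fixed prime is `𝔭 + I(𝔓, χ)`**: for a prime `𝔓` of `C = A[χ(Q)]` over
`𝔭` containing `χ(Q ∖ ℤF_𝔭)` (with (S)), `𝔪_{C_𝔓} = 𝔭·C_𝔓 + I(𝔓)·C_𝔓`, `I(𝔓) = (χ(q) : χ(q) ∈ 𝔓)`
Kato's ideal of the chart `χ` at `𝔓` (normal form of `J`, denominators `φ(f)` being units at `𝔓`).
[cite: Kato1994, Def. (2.1), (10.1)] -/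
theorem maximalIdeal_eq_sup_map (hPQ : P ≤ Q)
    (hχ : ∀ p : P, χ (Multiplicative.ofAdd ⟨(p : Fin n → ℤ), hPQ p.2⟩) =
      algebraMap A C (φ (Multiplicative.ofAdd p)))
    (hgen : Algebra.adjoin A (Set.range χ) = ⊤)
    (hS : ∀ q₁ ∈ Q, ∀ q₂ ∈ Q, q₁ + q₂ ∈ Submodule.span ℤ (faceMonoid P φ 𝔭 : Set (Fin n → ℤ)) →
      q₁ ∈ Submodule.span ℤ (faceMonoid P φ 𝔭 : Set (Fin n → ℤ)))
    {𝔓 : Ideal C} [𝔓.IsPrime] (h𝔓 : 𝔓.comap (algebraMap A C) = 𝔭)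
    (hq : ∀ q : Q, (q : Fin n → ℤ) ∉ Submodule.span ℤ (faceMonoid P φ 𝔭 : Set (Fin n → ℤ)) →
      χ (Multiplicative.ofAdd q) ∈ 𝔓) :
    maximalIdeal (Localization.AtPrime 𝔓) =
      𝔭.map (algebraMap A (Localization.AtPrime 𝔓)) ⊔
        (ideal Q χ 𝔓).map (algebraMap C (Localization.AtPrime 𝔓)) := by
  have hJ𝔓 : Ideal.span ((algebraMap A C '' (𝔭 : Set A)) ∪ ((fun q : Q => χ (Multiplicative.ofAdd q)) ''
      {q : Q | (q : Fin n → ℤ) ∉ Submodule.span ℤ (faceMonoid P φ 𝔭 : Set (Fin n → ℤ))})) ≤ 𝔓 := by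
    refine Ideal.span_le.2 ?_
    rintro _ (⟨π, hπ, rfl⟩ | ⟨q, hq', rfl⟩)
    · have : π ∈ 𝔓.comap (algebraMap A C) := by rw [h𝔓]; exact hπ
      exact this
    · exact hq q hq'
  refine le_antisymm ?_ ?_
  · rw [← Localization.AtPrime.map_eq_maximalIdeal, Ideal.map_le_iff_le_comap]
    intro x hx
    obtain ⟨f, hf, hfx⟩ := (mem_iff_exists_val_mul_mem_span hPQ hχ hgen h𝔓 hq x).1 hx
    obtain ⟨g, hg, π, hπ, y, hy, hEq⟩ := exists_val_mul_eq_add_of_mem_span hPQ hχ hgen hS hfx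
    rw [Ideal.mem_comap]
    -- `x = φ(g)⁻¹ φ(f)⁻¹ (π + y)` in `C_𝔓`
    have hu : IsUnit (algebraMap C (Localization.AtPrime 𝔓)
        (algebraMap A C (val P φ g) * algebraMap A C (val P φ f))) := by
      refine IsLocalization.map_units (Localization.AtPrime 𝔓) ⟨_, show _ ∈ 𝔓.primeCompl from ?_⟩
      intro hmem
      rcases Ideal.IsPrime.mem_or_mem ‹_› hmem with h1 | h1
      · have : val P φ g ∈ 𝔓.comap (algebraMap A C) := h1
        rw [h𝔓] at this; exact hg.2 this
      · have : val P φ f ∈ 𝔓.comap (algebraMap A C) := h1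
        rw [h𝔓] at this; exact hf.2 this
    have hEq' : algebraMap C (Localization.AtPrime 𝔓) x = ↑hu.unit⁻¹ *
        (algebraMap C (Localization.AtPrime 𝔓) (algebraMap A C π) +
          algebraMap C (Localization.AtPrime 𝔓) y) := by
      rw [← map_add, ← hEq, ← mul_assoc, map_mul (algebraMap C (Localization.AtPrime 𝔓))
        (algebraMap A C (val P φ g) * algebraMap A C (val P φ f)) x, ← mul_assoc, IsUnit.val_inv_mul, one_mul]
    rw [hEq']
    refine Ideal.mul_mem_left _ _ (Ideal.add_mem _ (Ideal.mem_sup_left ?_) (Ideal.mem_sup_right ?_))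
    · rw [← IsScalarTower.algebraMap_apply]
      exact Ideal.mem_map_of_mem _ hπ
    · refine Ideal.mem_map_of_mem _ ?_
      refine (Submodule.span_le.2 ?_ : Submodule.span A _ ≤ (ideal Q χ 𝔓).restrictScalars A) hy
      rintro _ ⟨q, hq', rfl⟩
      refine Ideal.subset_span ⟨q, ?_, rfl⟩
      exact hq q hq'
  · refine sup_le ?_ ?_
    · rw [Ideal.map_le_iff_le_comap]
      intro π hπ
      rw [Ideal.mem_comap, IsScalarTower.algebraMap_apply A C (Localization.AtPrime 𝔓),
        ← Localization.AtPrime.map_eq_maximalIdeal]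
      refine Ideal.mem_map_of_mem _ ?_
      have : π ∈ 𝔓.comap (algebraMap A C) := by rw [h𝔓]; exact hπ
      exact this
    · rw [← Localization.AtPrime.map_eq_maximalIdeal]
      exact Ideal.map_mono (ideal_le Q χ 𝔓)

end Summit.ResolutionOfSingularities.ResolutionOfSingularities.Theorems.FRationalResolution.ChartAlgebraFixedPoint

end
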